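import Summits.QuantumFields.BalabanUV.T4Continuum.Support.ShellMeasurePinnedNorm
import Summits.QuantumFields.BalabanUV.T4Continuum.Support.ShellMeasureAverageLocality148

/-!
# `T4Continuum.ShellMeasureLandauCfPinned` — row S70 companion CfP of the LOCALITY ROAD: THE (Cf) LETTER IS
# PINNED-QUADRATIC BY LOCALITY — END-II-loc's (44) binders `hCq` ∕ `hCd` in the pinned currency, VOLUME-FREE
(cell `pub-balaban`, sub-cell `t4`, spine estimate NE7c (node U5b); NE7c ROUND-2 crew, unit
`b2b-balaban-t4-ne7c-formalise-leaf-08` gen 13; owner table `t4/b2b-balaban-t4-ne7c-p1/LEAVES-NE7c-P1.md` v3.0 row S70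
«END-II-loc: the LD chain in two norms» (holder leaf-01-g6; companions by file: f2 leaf-07-g6, `DCf` leaf-08-g12, GP
leaf-06-g5, PB leaf-07-g6 (the GENERIC conjugated-derivative route, l.16834 — withdrawn in favour of the owner's S75
`ShellMeasurePinnedProp4` p225698), CfP this unit — journal «OFFER∕CLAIM S70
companion CfP» l.16756; owner RULING R-ne7cp1-g31-1 l.16870: the live-level END takes the «pinned GLOBAL scheme tuple»
from these companions); ADDITIVE — imports the owner's S69
`ShellMeasurePinnedNorm` (p223286: `pinW`, `norm_trunc_le`, `norm_toPiL_le_of_nonneg`) and leaf-04-g5's S68 (b)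
`ShellMeasureAverageLocality148` (p224210: `landauCf_congr`; hence row S64's `ShellMeasureLandauCorrectionB7`, p221284:
`landauCf`, `landauCorrection_binders`) ONLY; [folklore]; 0 `def`, 0 `def … : Prop`, 0 sorry, 0 new citation.)

HONEST FRAMING.  Finite four-torus programme, rung (B)+1 only — NOT infinite volume, NOT a mass gap, NOT the Clay
problem, NOT summit progress; (B), `BetaPertHyp`, (B^μ) not consumed.  NE7c (`T4IndicatorShell.ShellWeightBound`) is
NOT PRINTED in [Balaban 1983–89] and NOT PROVED; «NE7c ⇐ the named binders» (trigger c3).  Nothing printed is asserted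
beyond what rows S64 ∕ S68 (b) already carry with their own citation tags; no estimate of Bałaban's at a live level is
discharged; PLUMBING on OUR side.  HONEST DEPENDENCY (cell): continuum YM on T⁴ ⇐ BetaPertH ∧ nine spine estimates
(0/9 proved); BetaPertH ⇐ (D1) ∧ (D4) ∧ CAP+tail; G-an2-4 gates asym, D1 and NE2/3/4.

THE POINT.  Owner finding F-ne7cp1-g30-1 (GAPS l.25103): END-II of record is LOCALITY-BLIND, its slot constant is
volume-extensive at a live level; the repair (rows S69–S71) re-reads the LD chain with the exponent-field spaces
PINNED — `𝒴 := WSup (pinW δ′ ϖ) 1 𝔄` (S65 f2a ∕ S69: sup norm weighted by `e^{δ′ϖ(b)}`, `ϖ` = distance to the block).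
The pinned END (leaf-01-g6's `ShellMeasureLandauPinnedEnd.slotAC_realized_su2_landauChart_pinned`, S71 f2's
`ShellMeasureRayTermsPinnedLandau.hE_landau_chartRay_pinned`, the chain's (C) `…WeightEnd.slotAC_realized_su2_landauChart_twoSided`)
is GENERIC in the letter spaces and takes [Balaban1985Variational] (44)'s pair as BINDERS in whatever norm `𝒴'`, `𝒳`
carry: `hCq : ∀ Z : 𝒴', ‖Z‖ < R → ‖C Z‖ ≤ C₂‖Z‖²`, `hCd : DifferentiableOn ℂ C (ball 0 R)`.  In the pinned instance
`𝒳` MUST be pinned (else `hH : ‖H X‖_pin ≤ B₀‖X‖_flat` costs `e^{δ′·diam}`), hence so must `𝒴'` — and then `hCq` asks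
for the QUADRATIC bound of the Landau-correction letter `C` BETWEEN PINNED SPACES.  THIS FILE supplies it, volume-free,
from the FLAT pair + LOCALITY alone:

§1 GENERIC «A LOCAL QUADRATIC LETTER IS PINNED-QUADRATIC» (`norm_conj_le_sq_of_local`): `C : (Λ → 𝔄) → (Λ' → 𝔅)`
  with located supports `N c ⊆ Λ` (`C A c` depends on `A|_{N c}` only), pins `ϖ ≥ 0`, `ϖ' ≥ 0`, `δ′ ≥ 0` and the
  ONE-SIDED REACH `ϖ' c − r₀ ≤ ϖ b` for `b ∈ N c`; flat pair (`hCq`, `hCd`) on `ball 0 R` ⟹ for the SAME map read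
  between the pinned spaces, `Cpin := toPiL'.symm ∘ C ∘ toPiL : WSup (pinW δ′ ϖ) 1 𝔄 → WSup (pinW δ′ ϖ') 1 𝔅`:
  `‖Y‖_pin < R → ‖Cpin Y‖_pin ≤ (C₂·e^{2δ′r₀})·‖Y‖²_pin` and `DifferentiableOn ℂ Cpin (ball 0 R)`
  (`differentiableOn_conj`) — LITERALLY the `hCq`∕`hCd` shapes at the pinned spaces, same radius, `C₂ ↦ C₂e^{2δ′r₀}`.
  Proof (one output component `c`): `C Z c = C (trunc_{N c} Z) c` (locality); the truncation stays in the flat ball;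
  `‖trunc_{N c} Z‖_∞ ≤ e^{−δ′(ϖ'c − r₀)}·‖Y‖_pin` (S69 `norm_trunc_le` + reach); so
  `e^{δ′ϖ'c}·‖C Z c‖ ≤ C₂·e^{2δ′r₀}·e^{−δ′ϖ'c}·‖Y‖²_pin ≤ C₂e^{2δ′r₀}·‖Y‖²_pin`.  `reach_of_oneSided` records the
  intended inhabitant of the reach (S69's one-sided Lipschitz pin `ϖ' c ≤ ϖ b + ρ(c,b)` + located boxes `ρ ≤ r₀`);
  `mem_conj_of_mem` transports the real-structure image `hCr` (componentwise, unchanged).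
§2 THE TREE's (Cf) (`landauCf_pinned_sq`, `differentiableOn_landauCf_pinned`, `landauCf_pinned_binders`; §2b the
  concrete reach `reach_loK_of_coordLipschitz` for coordinate-Lipschitz pins and `landauCf_pinned_binders_coord`): row S64's
  `ShellMeasureLandauCorrectionB7.landauCf L U₀ k S S'` ([B7] (134) `C_k(U₀,·)` in the `A`-currency) with located supports
  `N c s :≡ BondIn (loK L k c) (bondHiK L k c) s` (the box `B^k(c₋) ∪ B^k(c₊)`; S68 (b) `landauCf_congr` IS the
  locality), flat pair = S64 `landauCorrection_binders` (`C₂ = C2cov d`, `R = landauRad d L`, k-UNIFORM, Prop. 2's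
  hypotheses on `U₀` VERBATIM) ⟹ the PINNED pair with `C2cov d·e^{2δ′r₀}` under the DISPLAYED reach binder
  `hreach : BondIn … s → ϖ' c − r₀ ≤ ϖ s` (geometry of the pin against the box; for `pinDist`-type pins, S69
  `pinDist_le_add`, `r₀` = the box's diameter in the pin's metric — SAID, an instance for the dictionary seat).

RELATION TO S75 (owner, `ShellMeasurePinnedProp4.pinned_quad_le`, p225698 — landed while this file was in its window):
S75 derives a pinned quadratic bound from a located quadratic MAJORANT KERNEL `‖W A c‖ ≤ ‖A‖·Σ_b k c b·‖A b‖` and pays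
the conjugated row sum `M = sup_c Σ_b k c b·e^{δ′ρ(c,b)}` — the right currency for (P4)∕(98)-type letters.  For the (Cf)
letter the tree's datum is S64's FLAT SUP pair + EXACT block-locality; routed through S75 it would need
`k c b := C₂·𝟙[b ∈ box c]`, i.e. `M = C₂·#box·e^{δ′r₀}` with `#box ∝ (2Lᵏ)^d` fine bonds — NOT k-uniform.  The sup route
below uses `(max_{box} ‖A b‖)²` instead of `‖A‖·Σ_{box} ‖A b‖` and gives `C₂·e^{2δ′r₀}` with NO cardinality — k-uniform.
Both are correct; this file is the (Cf)-specific sharpening and imports nothing of S75.  CONSUMER (owner RULING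
R-ne7cp1-g31-2, l.17079: «the GLOBAL∕PINNED scheme lives ENTIRELY inside the `hE` SUPPLIERS»): the pinned (44) slot of
S71 f2 `hE_landau_chartRay_pinned` ∕ S74's pinned Wilson squares, and the pinned hosts of record (p224390 ∕ p225579 §2).
η-BOOKKEEPING (NOTE N-ne7cp1-g31-3): `C₂ = C2cov d` is η-free in the `A`-currency (WALL v2.1 §2b row `Cf V`); the reach
`r₀` is measured in the PIN's units — with the pin in unit-lattice (`Lᵏ`-block) units, `r₀ < 2` (§2b, `ℓ = L^{−k}`).

DISPLAYED, NOT DISCHARGED (c2): nothing new — the reach is a geometric binder; S64's Prop. 2 hypotheses on `U₀` as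
there; W-c [dict] (that END-II's `Cf` IS Bałaban's (44) `C_j` on `Ω_j`, the `Lʲη`-scaling display) untouched.  NOT
HERE: the other pinned letters (`𝒢`, `H₁`, `H`, `ι` by S69 (A) ∕ GP; (P4) by GP ∕ S75; the fixed points by leaf-07-g6), the
pinned END itself (S70 f3∕f4); this file needs NO derivative decay for `Cf` — locality + the flat quadratic bound
suffice (S75's majorant route ∕ a derivative route serve letters without a flat sup quadratic bound); NE7c NOT PROVED; spine
PROVED 0∕9.
-/

noncomputable section

open Set Metric Finset

namespace Summit.QuantumFields.BalabanUV.T4Continuum.ShellMeasureLandauCfPinned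

open Summit.QuantumFields.BalabanUV.T4Continuum.ShellMeasureMultiGridNorms (WSup)
open Summit.QuantumFields.BalabanUV.T4Continuum.ShellMeasureMultiGridNorms.WSup (toPiL toPiL_apply toPiL_symm_apply
  norm_le_iff)
open Summit.QuantumFields.BalabanUV.T4Continuum.ShellMeasurePinnedNorm (pinW pinW_apply norm_trunc_le
  norm_toPiL_le_of_nonneg)

/-! ## §1 A local quadratic letter is pinned-quadratic -/

section Generic

variable {Λ Λ' : Type*} [Fintype Λ] [Fintype Λ']
variable {𝔄 𝔅 : Type*} [NormedAddCommGroup 𝔄] [NormedSpace ℂ 𝔄] [NormedAddCommGroup 𝔅] [NormedSpace ℂ 𝔅]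
variable {δ' : ℝ} {ϖ : Λ → ℝ} {ϖ' : Λ' → ℝ}

omit [Fintype Λ] [Fintype Λ'] in
/-- **THE INTENDED INHABITANT OF THE REACH** (bookkeeping): a pin that is one-sided Lipschitz for a cost `ρ`
(`ϖ' c ≤ ϖ b + ρ c b`, S69's convention) and located supports inside `ρ`-boxes of size `r₀` give the reach
`ϖ' c − r₀ ≤ ϖ b` on the supports. [folklore] -/
theorem reach_of_oneSided {S : Type*} (ρ : S → S → ℝ) (posIn : Λ → S) (posOut : Λ' → S)
    (hLip : ∀ c b, ϖ' c ≤ ϖ b + ρ (posOut c) (posIn b)) (N : Λ' → Λ → Prop) {r₀ : ℝ}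
    (hbox : ∀ c b, N c b → ρ (posOut c) (posIn b) ≤ r₀) : ∀ c b, N c b → ϖ' c - r₀ ≤ ϖ b :=
  fun c b hb => by linarith [hLip c b, hbox c b hb]

omit [NormedSpace ℂ 𝔄] in
/-- the flat truncation of a flat field to a finite set does not increase the sup norm. [folklore] -/
theorem norm_ite_le [DecidableEq Λ] (s : Finset Λ) (Z : Λ → 𝔄) : ‖(fun b => if b ∈ s then Z b else (0 : 𝔄))‖ ≤ ‖Z‖ := by
  refine (pi_norm_le_iff_of_nonneg (norm_nonneg Z)).2 fun b => ?_
  by_cases hb : b ∈ s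
  · rw [if_pos hb]; exact norm_le_pi_norm Z b
  · rw [if_neg hb, norm_zero]; exact norm_nonneg Z

/-- **A LOCAL QUADRATIC LETTER IS PINNED-QUADRATIC — END-II-loc's `hCq` IN THE PINNED CURRENCY, VOLUME-FREE.**
Data: a map `C : (Λ → 𝔄) → (Λ' → 𝔅)` on flat bond fields with LOCATED SUPPORTS `N c` (`C A c = C A' c` whenever
`A = A'` on `N c`); pins `ϖ ≥ 0` on `Λ`, `ϖ' ≥ 0` on `Λ'`, `δ′ ≥ 0`, and the one-sided REACH `ϖ' c − r₀ ≤ ϖ b` for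
`b ∈ N c`; the FLAT quadratic bound `‖Z‖ < R → ‖C Z‖ ≤ C₂‖Z‖²` (`0 ≤ C₂`).  CONCLUSION, for the same map read between
the pinned spaces (`Cpin Y := toPiL'.symm (C (toPiL Y))`): `‖Y‖_pin < R → ‖Cpin Y‖_pin ≤ (C₂·e^{2δ′r₀})·‖Y‖_pin²` —
LITERALLY the shape of the pinned END's binder `hCq` at `𝒴' := WSup (pinW δ′ ϖ) 1 𝔄`, `𝒳 := WSup (pinW δ′ ϖ') 1 𝔅`,
SAME radius.  Proof: per output component, locality + S69 `norm_trunc_le` + the reach. [folklore] -/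
theorem norm_conj_le_sq_of_local (hδ' : 0 ≤ δ') (hϖ : ∀ b, 0 ≤ ϖ b) (hϖ' : ∀ c, 0 ≤ ϖ' c)
    {C : (Λ → 𝔄) → (Λ' → 𝔅)} (N : Λ' → Λ → Prop)
    (hloc : ∀ A A' : Λ → 𝔄, ∀ c, (∀ b, N c b → A b = A' b) → C A c = C A' c)
    {r₀ : ℝ} (hreach : ∀ c b, N c b → ϖ' c - r₀ ≤ ϖ b)
    {C₂ R : ℝ} (hC₂ : 0 ≤ C₂) (hCq : ∀ Z : Λ → 𝔄, ‖Z‖ < R → ‖C Z‖ ≤ C₂ * ‖Z‖ ^ 2)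
    (Y : WSup (pinW δ' ϖ) 1 𝔄) (hY : ‖Y‖ < R) :
    ‖((toPiL (pinW δ' ϖ') 1).symm (C (toPiL (pinW δ' ϖ) 1 Y)) : WSup (pinW δ' ϖ') 1 𝔅)‖ ≤
      C₂ * Real.exp (2 * δ' * r₀) * ‖Y‖ ^ 2 := by
  classical
  set Z : Λ → 𝔄 := toPiL (pinW δ' ϖ) 1 Y with hZ
  have hZR : ‖Z‖ < R := (norm_toPiL_le_of_nonneg hδ' hϖ Y).trans_lt hY
  refine (norm_le_iff (pinW δ' ϖ') 1 (by positivity)).2 fun c => ?_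
  rw [pow_one, pinW_apply, toPiL_symm_apply]
  -- truncate the input to the located support of `c`
  set s : Finset Λ := Finset.univ.filter (N c) with hs
  set T : Λ → 𝔄 := fun b => if b ∈ s then Y b else (0 : 𝔄) with hT
  have hCT : C Z c = C T c := hloc Z T c fun b hb => by
    have hbs : b ∈ s := by rw [hs, Finset.mem_filter]; exact ⟨Finset.mem_univ b, hb⟩
    rw [hT]; dsimp only; rw [if_pos hbs, hZ, toPiL_apply]
  have hTZ : ‖T‖ ≤ ‖Z‖ := by
    have h := norm_ite_le s Z
    have e : (fun b => if b ∈ s then Z b else (0 : 𝔄)) = T := by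
      funext b; rw [hT]; dsimp only; rw [hZ, toPiL_apply]
    rwa [e] at h
  have hTR : ‖T‖ < R := hTZ.trans_lt hZR
  -- the truncation is exponentially small in the pin depth of `c` (reach)
  have hTpin : ‖T‖ ≤ Real.exp (-(δ' * (ϖ' c - r₀))) * ‖Y‖ :=
    norm_trunc_le s hδ' ϖ (fun b hb => hreach c b (by rw [hs, Finset.mem_filter] at hb; exact hb.2)) Y
  have hT0 : 0 ≤ Real.exp (-(δ' * (ϖ' c - r₀))) * ‖Y‖ := by positivity
  -- the flat quadratic bound at the truncation, one component
  have h1 : ‖C T c‖ ≤ C₂ * ‖T‖ ^ 2 := (norm_le_pi_norm (C T) c).trans (hCq T hTR)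
  have h2 : ‖T‖ ^ 2 ≤ (Real.exp (-(δ' * (ϖ' c - r₀))) * ‖Y‖) ^ 2 :=
    pow_le_pow_left₀ (norm_nonneg _) hTpin 2
  have hexp : Real.exp (δ' * ϖ' c) * Real.exp (-(δ' * (ϖ' c - r₀))) ^ 2 ≤ Real.exp (2 * δ' * r₀) := by
    rw [sq, ← Real.exp_add, ← Real.exp_add]
    exact Real.exp_le_exp.2 (by nlinarith [mul_nonneg hδ' (hϖ' c)])
  calc Real.exp (δ' * ϖ' c) * ‖C Z c‖ = Real.exp (δ' * ϖ' c) * ‖C T c‖ := by rw [hCT]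
    _ ≤ Real.exp (δ' * ϖ' c) * (C₂ * (Real.exp (-(δ' * (ϖ' c - r₀))) * ‖Y‖) ^ 2) :=
        mul_le_mul_of_nonneg_left (h1.trans (mul_le_mul_of_nonneg_left h2 hC₂)) (Real.exp_nonneg _)
    _ = C₂ * (Real.exp (δ' * ϖ' c) * Real.exp (-(δ' * (ϖ' c - r₀))) ^ 2) * ‖Y‖ ^ 2 := by ring
    _ ≤ C₂ * Real.exp (2 * δ' * r₀) * ‖Y‖ ^ 2 :=
        mul_le_mul_of_nonneg_right (mul_le_mul_of_nonneg_left hexp hC₂) (sq_nonneg _)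

/-- **… AND PINNED-DIFFERENTIABLE — END-II-loc's `hCd` IN THE PINNED CURRENCY.**  `DifferentiableOn ℂ C (ball 0 R)`
(flat) ⟹ `DifferentiableOn ℂ Cpin (ball 0 R)` (pinned, SAME radius): the pinned ball maps into the flat ball
(`‖toPiL Y‖ ≤ ‖Y‖_pin` for `ϖ ≥ 0`, `δ′ ≥ 0`) and S65 f2a's `toPiL` is a continuous linear equivalence. [folklore] -/
theorem differentiableOn_conj (hδ' : 0 ≤ δ') (hϖ : ∀ b, 0 ≤ ϖ b) (ϖ' : Λ' → ℝ)
    {C : (Λ → 𝔄) → (Λ' → 𝔅)} {R : ℝ} (hCd : DifferentiableOn ℂ C (ball 0 R)) :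
    DifferentiableOn ℂ
      (fun Y : WSup (pinW δ' ϖ) 1 𝔄 => ((toPiL (pinW δ' ϖ') 1).symm (C (toPiL (pinW δ' ϖ) 1 Y)) : WSup (pinW δ' ϖ') 1 𝔅))
      (ball 0 R) := by
  have hmaps : MapsTo (fun Y : WSup (pinW δ' ϖ) 1 𝔄 => toPiL (pinW δ' ϖ) 1 Y) (ball 0 R) (ball (0 : Λ → 𝔄) R) :=
    fun Y hY => by
    rw [mem_ball_zero_iff] at hY ⊢
    exact (norm_toPiL_le_of_nonneg hδ' hϖ Y).trans_lt hY
  have h1 : DifferentiableOn ℂ (fun Y : WSup (pinW δ' ϖ) 1 𝔄 => C (toPiL (pinW δ' ϖ) 1 Y)) (ball 0 R) :=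
    hCd.comp (toPiL (𝔄 := 𝔄) (pinW δ' ϖ) 1).toContinuousLinearMap.differentiable.differentiableOn hmaps
  exact (toPiL (𝔄 := 𝔅) (pinW δ' ϖ') 1).symm.toContinuousLinearMap.differentiable.comp_differentiableOn h1

/-- **THE REAL-STRUCTURE IMAGE `hCr` IS COMPONENTWISE, HENCE UNCHANGED**: if `C` maps a set `𝓡` of flat fields into
`𝓡'`, then `Cpin` maps `toPiL⁻¹ 𝓡` into `toPiL'⁻¹ 𝓡'`. [folklore] -/
theorem mem_conj_of_mem (ϖ : Λ → ℝ) (ϖ' : Λ' → ℝ) (δ' : ℝ)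
    {C : (Λ → 𝔄) → (Λ' → 𝔅)} {𝓡 : Set (Λ → 𝔄)} {𝓡' : Set (Λ' → 𝔅)} (hCr : ∀ Z ∈ 𝓡, C Z ∈ 𝓡')
    (Y : WSup (pinW δ' ϖ) 1 𝔄) (hY : toPiL (pinW δ' ϖ) 1 Y ∈ 𝓡) :
    toPiL (pinW δ' ϖ') 1 ((toPiL (pinW δ' ϖ') 1).symm (C (toPiL (pinW δ' ϖ) 1 Y))) ∈ 𝓡' := by
  rw [ContinuousLinearEquiv.apply_symm_apply]
  exact hCr _ hY

/-- **THE PAIR, BUNDLED** in the exact order of the pinned END's `(hCq, hCd)`. [folklore] -/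
theorem conj_binders_of_local (hδ' : 0 ≤ δ') (hϖ : ∀ b, 0 ≤ ϖ b) (hϖ' : ∀ c, 0 ≤ ϖ' c)
    {C : (Λ → 𝔄) → (Λ' → 𝔅)} (N : Λ' → Λ → Prop)
    (hloc : ∀ A A' : Λ → 𝔄, ∀ c, (∀ b, N c b → A b = A' b) → C A c = C A' c)
    {r₀ : ℝ} (hreach : ∀ c b, N c b → ϖ' c - r₀ ≤ ϖ b)
    {C₂ R : ℝ} (hC₂ : 0 ≤ C₂) (hCq : ∀ Z : Λ → 𝔄, ‖Z‖ < R → ‖C Z‖ ≤ C₂ * ‖Z‖ ^ 2)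
    (hCd : DifferentiableOn ℂ C (ball 0 R)) :
    (∀ Y : WSup (pinW δ' ϖ) 1 𝔄, ‖Y‖ < R →
        ‖((toPiL (pinW δ' ϖ') 1).symm (C (toPiL (pinW δ' ϖ) 1 Y)) : WSup (pinW δ' ϖ') 1 𝔅)‖ ≤
          C₂ * Real.exp (2 * δ' * r₀) * ‖Y‖ ^ 2) ∧
      DifferentiableOn ℂ
        (fun Y : WSup (pinW δ' ϖ) 1 𝔄 =>
          ((toPiL (pinW δ' ϖ') 1).symm (C (toPiL (pinW δ' ϖ) 1 Y)) : WSup (pinW δ' ϖ') 1 𝔅)) (ball 0 R) :=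
  ⟨fun Y hY => norm_conj_le_sq_of_local hδ' hϖ hϖ' N hloc hreach hC₂ hCq Y hY,
    differentiableOn_conj hδ' hϖ ϖ' hCd⟩

end Generic

/-! ## §2 The tree's (Cf): row S64's `landauCf` ([B7] (134) `C_k(U₀,·)`), block-local by S68 (b) -/

section B7

open Literature.MathematicalPhysics.QuantumFieldTheory.Balaban1983to89
open B7Prop1Local (loK bondHiK)
open B7Prop2Explicit (AvgClosed pdev C0 c2')
open B7Prop5Flat (BondIn)
open ShellMeasureAverageProp4General (C1cov C1cov_pos O1cov C2cov)
open ShellMeasureLandauCorrectionB7 (landauCf landauRad landauCorrection_binders)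
open ShellMeasureAverageLocality148 (landauCf_congr)

variable {d : ℕ} {𝔸 : Type*} [NormedRing 𝔸] [NormedAlgebra ℂ 𝔸] [CompleteSpace 𝔸] [NormOneClass 𝔸]

variable (L : ℕ) (hL : 2 ≤ L) {G : Subgroup 𝔸ˣ} (hG : AvgClosed d L G) (k : ℕ)
  (U₀ : B7Prop1Explicit.Site d → Fin d → 𝔸ˣ) (hU₀ : ∀ x κ, U₀ x κ ∈ G) {α₀ : ℝ} (hα : 0 < α₀)
  (hα3 : C0 d * α₀ ≤ 1 / 3) (hα4 : 4 * α₀ ≤ c2' d L) (hα6 : 4 * O1cov d * α₀ ≤ 1 / 3)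
  (h52 : pdev U₀ < α₀ * (((L : ℝ) ^ k)⁻¹) ^ 2) (S S' : Finset (B7Prop1Explicit.Site d × Fin d))

omit [CompleteSpace 𝔸] [NormOneClass 𝔸] in
/-- `0 ≤ C2cov d`. [folklore] -/
theorem C2cov_nonneg (d : ℕ) : 0 ≤ C2cov d := by
  have := C1cov_pos d
  unfold C2cov; positivity

include hL hG hU₀ hα hα3 hα4 hα6 h52 in
/-- **THE (Cf) LETTER OF THE TREE, PINNED — `hCq`.**  Row S64's `Cf := landauCf L U₀ k S S' : 𝔸^S → 𝔸^{S′}` (k-fold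
nonlinear part `C_k(U₀,·)` in the `A`-currency) read between the pinned spaces `WSup (pinW δ′ ϖ) 1 𝔸` (variables on
`S`) and `WSup (pinW δ′ ϖ') 1 𝔸` (`Lᵏ`-bonds of `S′`), pins `ϖ, ϖ' ≥ 0`, `δ′ ≥ 0`, under the DISPLAYED reach of the
pin against the box `B^k(c₋) ∪ B^k(c₊)` (`BondIn (loK L k c) (bondHiK L k c) s → ϖ' c − r₀ ≤ ϖ s`):
`‖Y‖_pin < landauRad d L → ‖Cf_pin Y‖_pin ≤ (C2cov d·e^{2δ′r₀})·‖Y‖²_pin` — S64 `landauCorrection_binders` (flat,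
k-uniform) + S68 (b) `landauCf_congr` (locality) through §1.  Prop. 2's hypotheses on `U₀` as in S64. [folklore] -/
theorem landauCf_pinned_sq {δ' r₀ : ℝ} (hδ' : 0 ≤ δ') (ϖ : ↥S → ℝ) (ϖ' : ↥S' → ℝ) (hϖ : ∀ b, 0 ≤ ϖ b)
    (hϖ' : ∀ c, 0 ≤ ϖ' c)
    (hreach : ∀ (c : ↥S') (s : ↥S), BondIn (loK L k c.1.1) (bondHiK L k c.1.1 c.1.2) s.1.1 s.1.2 → ϖ' c - r₀ ≤ ϖ s)
    (Y : WSup (pinW δ' ϖ) 1 𝔸) (hY : ‖Y‖ < landauRad d L) :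
    ‖((toPiL (pinW δ' ϖ') 1).symm (landauCf L U₀ k S S' (toPiL (pinW δ' ϖ) 1 Y)) : WSup (pinW δ' ϖ') 1 𝔸)‖ ≤
      C2cov d * Real.exp (2 * δ' * r₀) * ‖Y‖ ^ 2 :=
  norm_conj_le_sq_of_local hδ' hϖ hϖ'
    (fun (c : ↥S') (s : ↥S) => BondIn (loK L k c.1.1) (bondHiK L k c.1.1 c.1.2) s.1.1 s.1.2)
    (fun A A' c h => landauCf_congr (le_trans (by norm_num) hL) U₀ k S S' c h) hreach (C2cov_nonneg d)
    (landauCorrection_binders L hL hG k U₀ hU₀ hα hα3 hα4 hα6 h52 S S').1 Y hY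

include hL hG hU₀ hα hα3 hα4 hα6 h52 in
/-- **… `hCd`**: the same map is `ℂ`-differentiable on the pinned ball of radius `landauRad d L` (S64
`differentiableOn_landauCf` through §1 `differentiableOn_conj`). [folklore] -/
theorem differentiableOn_landauCf_pinned {δ' : ℝ} (hδ' : 0 ≤ δ') (ϖ : ↥S → ℝ) (ϖ' : ↥S' → ℝ)
    (hϖ : ∀ b, 0 ≤ ϖ b) :
    DifferentiableOn ℂ
      (fun Y : WSup (pinW δ' ϖ) 1 𝔸 =>
        ((toPiL (pinW δ' ϖ') 1).symm (landauCf L U₀ k S S' (toPiL (pinW δ' ϖ) 1 Y)) : WSup (pinW δ' ϖ') 1 𝔸))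
      (ball 0 (landauRad d L)) :=
  differentiableOn_conj hδ' hϖ ϖ' (landauCorrection_binders L hL hG k U₀ hU₀ hα hα3 hα4 hα6 h52 S S').2

include hL hG hU₀ hα hα3 hα4 hα6 h52 in
/-- **W-a (Cf) JUNCTION INTO END-II-loc — THE PINNED BINDER PAIR OF THE TREE's `Cf`, k-UNIFORM AND VOLUME-FREE**, in
the exact order `(hCq, hCd)` of `slotAC_realized_su2_landauChart_pinned` ∕ `hE_landau_chartRay_pinned` ∕ (C)
`_twoSided` at `𝒴' := WSup (pinW δ′ ϖ) 1 𝔸`, `𝒳 := WSup (pinW δ′ ϖ') 1 𝔸`: `C₂ := C2cov d·e^{2δ′r₀}`,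
`RC := landauRad d L` — neither sees `k`, `U₀`, `S`, `S′` or the volume; the reach `r₀` is the pin-diameter of one
box `B^k(c₋) ∪ B^k(c₊)` (DISPLAYED).  W-c [dict] untouched; nothing of Bałaban's at a live level discharged. [folklore] -/
theorem landauCf_pinned_binders {δ' r₀ : ℝ} (hδ' : 0 ≤ δ') (ϖ : ↥S → ℝ) (ϖ' : ↥S' → ℝ) (hϖ : ∀ b, 0 ≤ ϖ b)
    (hϖ' : ∀ c, 0 ≤ ϖ' c)
    (hreach : ∀ (c : ↥S') (s : ↥S), BondIn (loK L k c.1.1) (bondHiK L k c.1.1 c.1.2) s.1.1 s.1.2 → ϖ' c - r₀ ≤ ϖ s) :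
    (∀ Y : WSup (pinW δ' ϖ) 1 𝔸, ‖Y‖ < landauRad d L →
        ‖((toPiL (pinW δ' ϖ') 1).symm (landauCf L U₀ k S S' (toPiL (pinW δ' ϖ) 1 Y)) : WSup (pinW δ' ϖ') 1 𝔸)‖ ≤
          C2cov d * Real.exp (2 * δ' * r₀) * ‖Y‖ ^ 2) ∧
      DifferentiableOn ℂ
        (fun Y : WSup (pinW δ' ϖ) 1 𝔸 =>
          ((toPiL (pinW δ' ϖ') 1).symm (landauCf L U₀ k S S' (toPiL (pinW δ' ϖ) 1 Y)) : WSup (pinW δ' ϖ') 1 𝔸))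
        (ball 0 (landauRad d L)) :=
  ⟨fun Y hY => landauCf_pinned_sq L hL hG k U₀ hU₀ hα hα3 hα4 hα6 h52 S S' hδ' ϖ ϖ' hϖ hϖ' hreach Y hY,
    differentiableOn_landauCf_pinned L hL hG k U₀ hU₀ hα hα3 hα4 hα6 h52 S S' hδ' ϖ ϖ' hϖ⟩

/-! ### §2b A concrete reach: coordinate-Lipschitz pins read at the box corner -/

omit [NormedAlgebra ℂ 𝔸] [CompleteSpace 𝔸] [NormOneClass 𝔸] in
/-- **THE REACH FOR COORDINATE-LIPSCHITZ PINS.**  A site function `g` that is `ℓ`-Lipschitz for the sup-coordinate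
distance on `ℤ^d` (`(∀ i, x i − y i ≤ M ∧ y i − x i ≤ M) → g x ≤ g y + ℓ·M`), read on the fine bonds as `ϖ s := g s₋`
and on the `Lᵏ`-bonds as `ϖ' c := g (Lᵏc₋)` (the lower corner `loK` of the box), has the reach
`ϖ' c − ℓ·(2Lᵏ − 1) ≤ ϖ s` on the box `B^k(c₋) ∪ B^k(c₊)` (whose sup-coordinate extent from its corner is `2Lᵏ − 1`).
With `ℓ = L^{−k}` (the pin in COARSE units, matching a decay rate per `Lᵏ`-block) the reach is `< 2`. [folklore] -/
theorem reach_loK_of_coordLipschitz (hL1 : 1 ≤ L) {g : B7Prop1Explicit.Site d → ℝ} {ℓ : ℝ}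
    (hg : ∀ x y : B7Prop1Explicit.Site d, ∀ M : ℤ, (∀ i, x i - y i ≤ M ∧ y i - x i ≤ M) → g x ≤ g y + ℓ * M) :
    ∀ (c : ↥S') (s : ↥S), BondIn (loK L k c.1.1) (bondHiK L k c.1.1 c.1.2) s.1.1 s.1.2 →
      g (loK L k c.1.1) - ℓ * (2 * (L : ℝ) ^ k - 1) ≤ g s.1.1 := by
  intro c s hs
  obtain ⟨h1, -⟩ := hs
  have hP : (1 : ℤ) ≤ (L : ℤ) ^ k := one_le_pow₀ (by exact_mod_cast hL1)
  have hM : ∀ i, loK L k c.1.1 i - s.1.1 i ≤ 2 * (L : ℤ) ^ k - 1 ∧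
      s.1.1 i - loK L k c.1.1 i ≤ 2 * (L : ℤ) ^ k - 1 := fun i => by
    have h2 := (h1 i).1
    have h3 := (h1 i).2
    simp only [loK, bondHiK] at h2 h3 ⊢
    split_ifs at h3 <;> constructor <;> omega
  have h := hg (loK L k c.1.1) s.1.1 (2 * (L : ℤ) ^ k - 1) hM
  push_cast at h
  linarith

include hL hG hU₀ hα hα3 hα4 hα6 h52 in
/-- **THE PINNED PAIR OF THE TREE's `Cf` WITH A COORDINATE-LIPSCHITZ PIN** (§2 + §2b): pins `ϖ s := g s₋`,
`ϖ' c := g (Lᵏc₋)` for a nonnegative `ℓ`-coordinate-Lipschitz site function `g` (e.g. `L^{−k}` × the sup-distance to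
the block; `ℓ` of either sign is allowed, `ℓ ≥ 0` is the meaningful case), constant `C2cov d·e^{2δ′ℓ(2Lᵏ − 1)}` —
with `ℓ = L^{−k}`: `≤ C2cov d·e^{4δ′}`, k-UNIFORM and VOLUME-FREE. [folklore] -/
theorem landauCf_pinned_binders_coord {δ' ℓ : ℝ} (hδ' : 0 ≤ δ') {g : B7Prop1Explicit.Site d → ℝ}
    (hg0 : ∀ x, 0 ≤ g x)
    (hg : ∀ x y : B7Prop1Explicit.Site d, ∀ M : ℤ, (∀ i, x i - y i ≤ M ∧ y i - x i ≤ M) → g x ≤ g y + ℓ * M) :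
    (∀ Y : WSup (pinW δ' (fun s : ↥S => g s.1.1)) 1 𝔸, ‖Y‖ < landauRad d L →
        ‖((toPiL (pinW δ' (fun c : ↥S' => g (loK L k c.1.1))) 1).symm
            (landauCf L U₀ k S S' (toPiL (pinW δ' (fun s : ↥S => g s.1.1)) 1 Y)) :
            WSup (pinW δ' (fun c : ↥S' => g (loK L k c.1.1))) 1 𝔸)‖ ≤
          C2cov d * Real.exp (2 * δ' * (ℓ * (2 * (L : ℝ) ^ k - 1))) * ‖Y‖ ^ 2) ∧
      DifferentiableOn ℂ
        (fun Y : WSup (pinW δ' (fun s : ↥S => g s.1.1)) 1 𝔸 =>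
          ((toPiL (pinW δ' (fun c : ↥S' => g (loK L k c.1.1))) 1).symm
            (landauCf L U₀ k S S' (toPiL (pinW δ' (fun s : ↥S => g s.1.1)) 1 Y)) :
            WSup (pinW δ' (fun c : ↥S' => g (loK L k c.1.1))) 1 𝔸))
        (ball 0 (landauRad d L)) :=
  landauCf_pinned_binders L hL hG k U₀ hU₀ hα hα3 hα4 hα6 h52 S S' hδ' (fun s : ↥S => g s.1.1)
    (fun c : ↥S' => g (loK L k c.1.1)) (fun s => hg0 _) (fun c => hg0 _)
    (reach_loK_of_coordLipschitz L k S S' (le_trans (by norm_num) hL) hg)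

end B7

/-! ## §3 Non-vacuity of §1: a local quadratic letter on two sites -/

section Toy

/-- TOY: `Λ = Λ' = Fin 2`, `𝔄 = 𝔅 = ℂ`, `C A c := (A c)²` (support `N c = {c}`, reach `r₀ = 0` for equal pins):
§1 gives `‖Cpin Y‖_pin ≤ 1·e^{0}·‖Y‖²_pin` on every ball. [folklore] -/
example (δ' : ℝ) (hδ' : 0 ≤ δ') (ϖ : Fin 2 → ℝ) (hϖ : ∀ b, 0 ≤ ϖ b) (Y : WSup (pinW δ' ϖ) 1 ℂ) (hY : ‖Y‖ < 1) :
    ‖((toPiL (pinW δ' ϖ) 1).symm ((fun A : Fin 2 → ℂ => fun c => A c ^ 2) (toPiL (pinW δ' ϖ) 1 Y)) :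
        WSup (pinW δ' ϖ) 1 ℂ)‖ ≤ 1 * Real.exp (2 * δ' * 0) * ‖Y‖ ^ 2 := by
  refine norm_conj_le_sq_of_local (C := fun A : Fin 2 → ℂ => fun c => A c ^ 2) hδ' hϖ hϖ (fun c b => b = c)
    (fun A A' c h => by simp only [h c rfl]) (fun c b hb => by subst hb; linarith) zero_le_one
    (fun Z _ => ?_) Y hY
  refine (pi_norm_le_iff_of_nonneg (by positivity)).2 fun c => ?_
  rw [norm_pow, one_mul]
  exact pow_le_pow_left₀ (norm_nonneg _) (norm_le_pi_norm Z c) 2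

end Toy

end Summit.QuantumFields.BalabanUV.T4Continuum.ShellMeasureLandauCfPinned

end
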